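import Summits.QuantumFields.BalabanUV.Beta.FP.PerfectMaxwellSymbol

/-!
# `BalabanUV.Beta.FP.PerfectMaxwellElliptic` — road «FP» for binder row D1, leaf H2-P input (P-i) COMPLETED (owner ruling R-FP-15; `HOME/b2b-balaban-beta-d1-p3/H2-DESIGN.md` §5):
# the LAGRANGE IDENTITY for the plain Maxwell form and the UNIFORM ELLIPTICITY of the Feynman-completed weighted Maxwell symbol —
# `γ·‖ph‖²·‖v‖² ≤ maxwellQ W ph v + ‖⟪ph, v⟫‖² ≤ Γ·‖ph‖²·‖v‖²` for `γ ≤ W ≤ Γ`, `γ ≤ 1 ≤ Γ`; instance: the continuum (1.66) weights `Re W_∞` on the real zone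

HONEST DEPENDENCY (page 1, mandatory): continuum YM on T⁴ ⇐ BetaPertH ∧ nine spine estimates (0/9 proved); BetaPertH ⇐ (D1) ∧ (D4) ∧ CAP+tail;
G-an2-4 gates asym, D1 and NE2/3/4.  HONEST FRAMING (cell contract, verbatim): «discharging `BetaPertH` makes Bałaban's UV stability UNCONDITIONAL —
a real constructive-QFT result; it is NOT the continuum limit and NOT the Clay problem.»  THIS MODULE DISCHARGES NOTHING of the wall: [folklore] algebra of finite
sums over `Fin d` (Mathlib) on top of `FP/PerfectMaxwellSymbol` (the weighted Maxwell form `maxwellQ`, its comparison lemmas, the `W_∞` instance).  No `def`, no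
`def … : Prop`, nothing cited as a hypothesis, 0 sorry; 0 wall binders; NOT D1, NOT BetaPertH, NOT continuum, NOT Clay.

ABSOLUTE RULE (cell charter, verbatim): «No internally-minted statement may enter as a cited fact. Every hypothesis is either kernel-proved in this package or a
verbatim quotation of a PUBLISHED theorem with page reference. The manuscript(s) under audit are NOT citable for their own disputed steps — they are the thing
under adjudication; programme-internal (2001/route/tribunal) claims are never citable.»

WHAT.  §1 `lagrange_identity` (the two one-line `normSq` facts it needs are inlined, not re-declared — they exist elsewhere in the tree): `Σ_μ Σ_ν ½‖a_μ b_ν − a_ν b_μ‖² = (Σ‖a_μ‖²)(Σ‖b_ν‖²) − ‖Σ_μ a_μ·conj(b_μ)‖²` over `ℂ`; `maxwellQ_one_eq`: the PLAIN Maxwell form is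
`‖ph‖²‖v‖² − ‖⟪ph,v⟫‖²` (`⟪ph,v⟫ := Σ_μ ph μ·conj(v μ)`; its norm is that of the lattice divergence symbol `Σ conj(ph μ)·v μ`).  §2 the FEYNMAN-COMPLETED form
`maxwellQ W ph v + ‖⟪ph,v⟫‖²` (the `ξ = 1` lattice slice term added to the weighted Maxwell form): **`feynman_lower`** — `γ ≤ W μ ν` off the diagonal and `γ ≤ 1` ⟹
`γ·‖ph‖²‖v‖² ≤ maxwellQ W ph v + ‖⟪ph,v⟫‖²` (UNIFORM ELLIPTICITY: no transversality condition on `v`); **`feynman_upper`** — `W ≤ Γ`, `1 ≤ Γ` ⟹ `… ≤ Γ·‖ph‖²‖v‖²`.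
§3 **`perfectFeynman_lower`** ∕ `perfectFeynman_upper`: the instance `W := Re W_∞(·,·; s)` on the real Brillouin zone with `γ = (4/π²)^{d+2}` (whole zone) and
`Γ = (π²/4)^{2d+4}` (punctured zone) — `FP/PerfectSymbol166Pos` + `FP/PerfectMaxwellSymbol` BY NAME.  READING (road FP, H2-P): with `ph a := e^{is_a} − 1` this says the
BF-Feynman-completed symbol `M(s) + p̂p̂†` of the perfect Laplacian is bounded below by `γ|p̂(s)|²·𝟙` and above by `Γ|p̂(s)|²·𝟙` at EVERY real momentum — so its inverse,
the symbol of the UNCONSTRAINED perfect propagator `P∞`, exists for `s ≠ 0` with `‖P∞sym(s)‖ ≤ 1/(γ|p̂(s)|²)`: the invertibility input (P-i) of road FP's analytic leaf (H2),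
modulo the dictionary row H2-P-DICT (`maxwellQ (Re W_∞) ph` IS the Fourier form of `deltaZLim`).
Provenance: road FP owner b2b-balaban-beta-d1-p3 gen 4 (prover-b2b-balaban-beta-d1-p3-g4-0), 2026-08-20.
-/

noncomputable section

namespace Summit.QuantumFields.BalabanUV.Beta.FP.PerfectMaxwellElliptic

open Finset
open scoped BigOperators ComplexConjugate
open Literature.MathematicalPhysics.QuantumFieldTheory.Balaban1983to89
open B4Strip (ofRealVec)
open B4ContourShift (BZ)
open Summit.QuantumFields.BalabanUV.Beta.FP.PerfectSymbol166 (W166Inf)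
open Summit.QuantumFields.BalabanUV.Beta.FP.PerfectMaxwellSymbol (maxwellQ maxwellQ_ge_of_le maxwellQ_le_of_le maxwellQ_W166Inf_lower maxwellQ_W166Inf_upper)

variable {d : ℕ}

/-! ## §1 The Lagrange identity and the closed form of the plain Maxwell form -/

/-- [folklore] **THE LAGRANGE IDENTITY OVER `ℂ`**: `Σ_μ Σ_ν ½‖a_μ b_ν − a_ν b_μ‖² = (Σ_μ ‖a_μ‖²)(Σ_ν ‖b_ν‖²) − ‖Σ_μ a_μ conj(b_μ)‖²`. -/
theorem lagrange_identity (a b : Fin d → ℂ) :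
    ∑ μ, ∑ ν, (1 / 2 : ℝ) * ‖a μ * b ν - a ν * b μ‖ ^ 2
      = (∑ μ, ‖a μ‖ ^ 2) * (∑ ν, ‖b ν‖ ^ 2) - ‖∑ μ, a μ * conj (b μ)‖ ^ 2 := by
  have key : ∀ μ ν, ‖a μ * b ν - a ν * b μ‖ ^ 2
      = ‖a μ‖ ^ 2 * ‖b ν‖ ^ 2 + ‖a ν‖ ^ 2 * ‖b μ‖ ^ 2 - 2 * ((a μ * conj (b μ)) * conj (a ν * conj (b ν))).re := by
    intro μ ν
    have hxy : ∀ x y : ℂ, ‖x - y‖ ^ 2 = ‖x‖ ^ 2 + ‖y‖ ^ 2 - 2 * (x * conj y).re := fun x y => by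
      rw [← Complex.normSq_eq_norm_sq, ← Complex.normSq_eq_norm_sq, ← Complex.normSq_eq_norm_sq, Complex.normSq_sub]
    rw [hxy, norm_mul, norm_mul, mul_pow, mul_pow]
    have : (a μ * b ν * conj (a ν * b μ)) = ((a μ * conj (b μ)) * conj (a ν * conj (b ν))) := by
      simp only [map_mul, Complex.conj_conj]; ring
    rw [this]
  simp_rw [key]
  set z : ℂ := ∑ μ, a μ * conj (b μ) with hz
  have hzz : z * conj z = ∑ μ, ∑ ν, (a μ * conj (b μ)) * conj (a ν * conj (b ν)) := by
    rw [hz, map_sum, Finset.sum_mul_sum]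
  have hre : (∑ μ, ∑ ν, ((a μ * conj (b μ)) * conj (a ν * conj (b ν))).re) = ‖z‖ ^ 2 := by
    have hzre : (z * conj z).re = ‖z‖ ^ 2 := by rw [Complex.mul_conj, Complex.ofReal_re, Complex.normSq_eq_norm_sq]
    rw [← hzre, hzz, Complex.re_sum]
    exact Finset.sum_congr rfl fun μ _ => (Complex.re_sum _ _).symm
  have h1 : ∑ μ, ∑ ν, ‖a μ‖ ^ 2 * ‖b ν‖ ^ 2 = (∑ μ, ‖a μ‖ ^ 2) * (∑ ν, ‖b ν‖ ^ 2) := by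
    rw [Finset.sum_mul_sum]
  have h2 : ∑ μ, ∑ ν, ‖a ν‖ ^ 2 * ‖b μ‖ ^ 2 = (∑ μ, ‖a μ‖ ^ 2) * (∑ ν, ‖b ν‖ ^ 2) := by
    rw [Finset.sum_comm, Finset.sum_mul_sum]
  have hsplit : ∑ μ, ∑ ν, (1 / 2 : ℝ) * (‖a μ‖ ^ 2 * ‖b ν‖ ^ 2 + ‖a ν‖ ^ 2 * ‖b μ‖ ^ 2
        - 2 * ((a μ * conj (b μ)) * conj (a ν * conj (b ν))).re)
      = (1 / 2 : ℝ) * (∑ μ, ∑ ν, ‖a μ‖ ^ 2 * ‖b ν‖ ^ 2) + (1 / 2 : ℝ) * (∑ μ, ∑ ν, ‖a ν‖ ^ 2 * ‖b μ‖ ^ 2)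
        - ∑ μ, ∑ ν, ((a μ * conj (b μ)) * conj (a ν * conj (b ν))).re := by
    have : ∀ μ ν, (1 / 2 : ℝ) * (‖a μ‖ ^ 2 * ‖b ν‖ ^ 2 + ‖a ν‖ ^ 2 * ‖b μ‖ ^ 2
        - 2 * ((a μ * conj (b μ)) * conj (a ν * conj (b ν))).re)
        = (1 / 2 : ℝ) * (‖a μ‖ ^ 2 * ‖b ν‖ ^ 2) + (1 / 2 : ℝ) * (‖a ν‖ ^ 2 * ‖b μ‖ ^ 2)
          - ((a μ * conj (b μ)) * conj (a ν * conj (b ν))).re := fun μ ν => by ring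
    simp_rw [this, Finset.sum_sub_distrib, Finset.sum_add_distrib, ← Finset.mul_sum]
  rw [hsplit, hre, h1, h2]; ring

/-- [folklore] The `μ = ν` exclusion in `maxwellQ` is immaterial for the plain form: the diagonal terms vanish. -/
theorem maxwellQ_one_eq_sum (ph v : Fin d → ℂ) :
    maxwellQ (fun _ _ => (1 : ℝ)) ph v = ∑ μ, ∑ ν, (1 / 2 : ℝ) * ‖ph μ * v ν - ph ν * v μ‖ ^ 2 := by
  unfold maxwellQ
  refine Finset.sum_congr rfl fun μ _ => Finset.sum_congr rfl fun ν _ => ?_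
  split_ifs with h
  · subst h; simp
  · rw [mul_one]

/-- [folklore] **THE PLAIN MAXWELL FORM IN CLOSED FORM**: `maxwellQ 1 ph v = (Σ‖ph μ‖²)(Σ‖v μ‖²) − ‖Σ_μ ph μ·conj(v μ)‖²`. -/
theorem maxwellQ_one_eq (ph v : Fin d → ℂ) :
    maxwellQ (fun _ _ => (1 : ℝ)) ph v = (∑ μ, ‖ph μ‖ ^ 2) * (∑ ν, ‖v ν‖ ^ 2) - ‖∑ μ, ph μ * conj (v μ)‖ ^ 2 := by
  rw [maxwellQ_one_eq_sum, lagrange_identity]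

/-- [folklore] Cauchy–Schwarz in this currency: `‖⟪ph,v⟫‖² ≤ (Σ‖ph‖²)(Σ‖v‖²)` (the plain Maxwell form is nonnegative). -/
theorem inner_sq_le (ph v : Fin d → ℂ) : ‖∑ μ, ph μ * conj (v μ)‖ ^ 2 ≤ (∑ μ, ‖ph μ‖ ^ 2) * (∑ ν, ‖v ν‖ ^ 2) := by
  have h := PerfectMaxwellSymbol.maxwellQ_one_nonneg ph v
  rw [maxwellQ_one_eq] at h
  linarith

/-! ## §2 Uniform ellipticity of the Feynman-completed weighted form -/

/-- [folklore] **UNIFORM ELLIPTICITY (lower)**: `γ ≤ W μ ν` for `μ ≠ ν` and `γ ≤ 1` ⟹ `γ·(Σ‖ph‖²)(Σ‖v‖²) ≤ maxwellQ W ph v + ‖⟪ph,v⟫‖²` — the `ξ = 1` slice term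
completes the transverse coercivity to coercivity on ALL amplitudes. -/
theorem feynman_lower {W : Fin d → Fin d → ℝ} {γ : ℝ} (hW : ∀ μ ν, μ ≠ ν → γ ≤ W μ ν) (hγ1 : γ ≤ 1) (ph v : Fin d → ℂ) :
    γ * ((∑ μ, ‖ph μ‖ ^ 2) * (∑ ν, ‖v ν‖ ^ 2)) ≤ maxwellQ W ph v + ‖∑ μ, ph μ * conj (v μ)‖ ^ 2 := by
  have h := maxwellQ_ge_of_le hW ph v
  rw [maxwellQ_one_eq] at h
  have hS : 0 ≤ ‖∑ μ, ph μ * conj (v μ)‖ ^ 2 := sq_nonneg _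
  nlinarith

/-- [folklore] **UNIFORM BOUNDEDNESS (upper)**: `W μ ν ≤ Γ` for `μ ≠ ν` and `1 ≤ Γ` ⟹ `maxwellQ W ph v + ‖⟪ph,v⟫‖² ≤ Γ·(Σ‖ph‖²)(Σ‖v‖²)`. -/
theorem feynman_upper {W : Fin d → Fin d → ℝ} {Γ : ℝ} (hW : ∀ μ ν, μ ≠ ν → W μ ν ≤ Γ) (hΓ1 : 1 ≤ Γ) (ph v : Fin d → ℂ) :
    maxwellQ W ph v + ‖∑ μ, ph μ * conj (v μ)‖ ^ 2 ≤ Γ * ((∑ μ, ‖ph μ‖ ^ 2) * (∑ ν, ‖v ν‖ ^ 2)) := by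
  have h := maxwellQ_le_of_le hW ph v
  rw [maxwellQ_one_eq] at h
  have hS : 0 ≤ ‖∑ μ, ph μ * conj (v μ)‖ ^ 2 := sq_nonneg _
  have hCS := inner_sq_le ph v
  nlinarith

/-! ## §3 Instance: the continuum (1.66) weights — the Feynman-completed perfect Laplacian symbol is uniformly elliptic -/

/-- [folklore] `(4/π²)^{d+2} ≤ 1`. -/
theorem lower_const_le_one : (4 / Real.pi ^ 2 : ℝ) ^ (d + 2) ≤ 1 := by
  have hπ : (4 / Real.pi ^ 2 : ℝ) ≤ 1 := by
    rw [div_le_one (by positivity)]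
    nlinarith [Real.pi_gt_three]
  exact pow_le_one₀ (by positivity) hπ

/-- [folklore] `1 ≤ (π²/4)^{2d+4}`. -/
theorem one_le_upper_const : (1 : ℝ) ≤ (Real.pi ^ 2 / 4) ^ (2 * d + 4) := by
  have hπ : (1 : ℝ) ≤ Real.pi ^ 2 / 4 := by
    rw [le_div_iff₀ (by norm_num)]
    nlinarith [Real.pi_gt_three]
  exact one_le_pow₀ hπ

/-- [our object] **UNIFORM ELLIPTICITY OF THE FEYNMAN-COMPLETED PERFECT LAPLACIAN SYMBOL** (lower, WHOLE real zone): with `W μ ν := Re W_∞(μ,ν; s)`,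
`(4/π²)^{d+2}·(Σ‖ph‖²)(Σ‖v‖²) ≤ maxwellQ W ph v + ‖⟪ph,v⟫‖²` for every `ph`, `v` — with `ph a := e^{is_a} − 1`: `M(s) + p̂p̂† ≥ (4/π²)^{d+2}·|p̂(s)|²·𝟙`. -/
theorem perfectFeynman_lower {s : Fin d → ℝ} (hs : s ∈ BZ d) (ph v : Fin d → ℂ) :
    (4 / Real.pi ^ 2) ^ (d + 2) * ((∑ μ, ‖ph μ‖ ^ 2) * (∑ ν, ‖v ν‖ ^ 2))
      ≤ maxwellQ (fun μ ν => (W166Inf μ ν (ofRealVec s)).re) ph v + ‖∑ μ, ph μ * conj (v μ)‖ ^ 2 :=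
  feynman_lower (fun _ _ hμν => PerfectSymbol166Pos.W166Inf_ofReal_re_lower hμν hs) lower_const_le_one ph v

/-- [our object] … and the upper side on the PUNCTURED real zone: `maxwellQ W ph v + ‖⟪ph,v⟫‖² ≤ (π²/4)^{2d+4}·(Σ‖ph‖²)(Σ‖v‖²)`. -/
theorem perfectFeynman_upper {s : Fin d → ℝ} (hs : s ∈ BZ d) (ν₀ : Fin d) (hν₀ : s ν₀ ≠ 0) (ph v : Fin d → ℂ) :
    maxwellQ (fun μ ν => (W166Inf μ ν (ofRealVec s)).re) ph v + ‖∑ μ, ph μ * conj (v μ)‖ ^ 2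
      ≤ (Real.pi ^ 2 / 4) ^ (2 * d + 4) * ((∑ μ, ‖ph μ‖ ^ 2) * (∑ ν, ‖v ν‖ ^ 2)) :=
  feynman_upper (fun _ _ hμν => (PerfectSymbol166Pos.W166Inf_ofReal_re_bounds hμν hs ν₀ hν₀).2) one_le_upper_const ph v

end Summit.QuantumFields.BalabanUV.Beta.FP.PerfectMaxwellElliptic

end
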